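import Mathlib
import HarnessLib
import Summits.Ventures.LatticeQCDFlow.Scaling.AcceptanceEssEightNinthsRigidityDensities
import Summits.Ventures.LatticeQCDFlow.Scaling.U1IdentityFlowVolumeLaw
import Summits.Ventures.LatticeQCDFlow.Scaling.WilsonIdentityFlowLaw

/-!
# LatticeQCDFlow / Scaling — the `acc ≥ (8/9)·ESS` law is STRICT for every flow whose importance
# weight is bounded below; the untrained Wilson samplers: `(8/9)·Z(β)²/Z(2β) < acc`

HONEST FRAMING: exact (Metropolis-corrected) sampling algorithms for lattice gauge theory;
figures of merit are autocorrelation/cost numbers at stated couplings and volumes; no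
continuum-physics claim.

Venture `LatticeQCDFlow` (cell pub-lqcd), topic `Scaling`; FANOUT row 3 (`s0-u1-a`, S0-B
implementation A, GEN-14).  NEW WORK of the cell (elementary), a corollary of row 3's rigidity of the
`(8/9)·ESS` floor (`Scaling/AcceptanceEssEightNinthsRigidityDensities`, imported: equality iff the
model mass of `{w/q > t}` is the ramp `(4Z²/(3W₂) − (8Z³/(9W₂²))·t)₊` for every `t > 0`), in row 2's
density vocabulary (`(X, μ)` s-finite, weight `w > 0`, model `q > 0` with `∫ q = 1`, `Z = ∫ w`,
`W₂ = ∫ (w/q)·w`, `κ = ESS = Z²/W₂`), applied to row 3's untrained baselines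
(`Scaling/U1IdentityFlowVolumeLaw`, `Scaling/WilsonIdentityFlowLaw`, imported).  NO definition.

* §1 **`integral_integral_min_mul_gt_eight_ninths_of_weight_ge`** — if the importance ratio is
  bounded below, `w/q ≥ t₀ > 0`, then `∫∫ min(w(x)q(y), w(y)q(x)) > (8/9)·Z³/W₂` STRICTLY: below `t₀`
  the model mass of `{w/q > t}` is the full mass `1`, and no ramp with positive slope is constant on
  an interval; **`meanAccept_overlapForm_gt_eight_ninths_ESS`** — the normalised form
  `acc(p, q) > (8/9)·κ`, `p = w/Z`;
* §2 ANY compact gauge group, any reference probability law `μ` (the untrained Wilson sampler of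
  `Scaling/WilsonIdentityFlowLaw`): the action is bounded (`|Re tr ρ| ≤ N`, unitary trick), so the
  tilt `e^{−βS}` is bounded below and **`wilsonIdentityFlow_meanAccept_gt`**:
  `(8/9)·Z(β)²/Z(2β) < acc` for EVERY `β` (`…_partitionFunction` for `μ = Haar^{⊗E}`);
* §3 `V` independent U(1) plaquettes (`Scaling/U1IdentityFlowVolumeLaw`):
  **`u1IdentityFlow_meanAccept_gt`** — `(8/9)·(I₀(β)²/I₀(2β))^V < acc_V` for every `β` and `V`
  (the weight `∏ 2π e^{β cos θᵢ}/Z₁(β) ≥ (2π e^{−|β|}/Z₁(β))^V`).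

Reading (value-free): GEN-12/13's two-sided laws `(8/9)·ESS ≤ acc ≤ BC²` for the untrained exact
samplers are strict on BOTH sides (the ceiling side is row 3's `Scaling/IdentityFlowStrictLaws`): an
acceptance equal to `8/9` of the effective sample size requires an atom of zero-weight proposals,
which a Boltzmann tilt never has.  NOT CLAIMED: the size of the excess; flows with unbounded
log-weights (there the floor can be approached); any acceptance VALUE of ours; nothing re-scored.
-/

noncomputable section

namespace Summit.Ventures.LatticeQCDFlow.Theory2

open MeasureTheory Real Set Finset Filter
open Summit.Ventures.LatticeQCDFlow.Exactness
open Literature.Analysis.FunctionSpaces (besselI besselI_zero_pos)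
open Literature.MathematicalPhysics.QuantumFieldTheory
open Summit.Ventures.LatticeQCDFlow.Scoring (onePlaquetteZ onePlaquetteZ_pos onePlaquetteZ_eq_besselI)

/-! ## §1 A weight bounded below makes the `(8/9)·ESS` floor strict -/

section General

variable {X : Type*} [MeasurableSpace X] {μ : Measure X} [SFinite μ] {w q : X → ℝ}

/-- **THE `(8/9)·ESS` FLOOR IS STRICT FOR A WEIGHT BOUNDED BELOW**: if `w/q ≥ t₀ > 0` everywhere then
`∫∫ min(w(x)q(y), w(y)q(x)) dμ dμ > (8/9)·Z³/W₂`.  In the equality case the model mass of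
`{w/q > t}` would be the ramp `(4Z²/(3W₂) − (8Z³/(9W₂²))·t)₊` for all `t > 0`; but for `t < t₀` that
mass is `∫ q = 1`, and a ramp of positive slope `8Z³/(9W₂²)` is not constant on `(0, t₀)`. [ours] -/
theorem integral_integral_min_mul_gt_eight_ninths_of_weight_ge (hw0 : ∀ t, 0 < w t)
    (hwm : Measurable w) (hwi : Integrable w μ) (hq0 : ∀ t, 0 < q t) (hqm : Measurable q)
    (hqi : Integrable q μ) (hq1 : ∫ z, q z ∂μ = 1) (hW₂ : Integrable (fun x => w x / q x * w x) μ)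
    {t₀ : ℝ} (ht₀ : 0 < t₀) (hb : ∀ x, t₀ ≤ w x / q x) :
    8 * (∫ z, w z ∂μ) ^ 3 / (9 * ∫ z, w z / q z * w z ∂μ)
      < ∫ x, ∫ y, min (w x * q y) (w y * q x) ∂μ ∂μ := by
  refine lt_of_le_of_ne (eight_ninths_le_integral_integral_min_mul hw0 hwm hwi hq0 hqm hqi hq1 hW₂)
    fun heq => ?_
  have hramp := (integral_integral_min_mul_eq_eight_ninths_iff hw0 hwm hwi hq0 hqm hqi hq1 hW₂).1
    heq.symm
  set Z : ℝ := ∫ z, w z ∂μ with hZdef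
  set W : ℝ := ∫ z, w z / q z * w z ∂μ with hWdef
  have hZ : 0 < Z := integral_pos_of_pos hw0 hwi hq1
  have hW : 0 < W := integral_pos_of_pos (fun x => mul_pos (div_pos (hw0 x) (hq0 x)) (hw0 x)) hW₂ hq1
  -- below `t₀` the super-level set of the ratio is everything
  have hfull : ∀ t, t < t₀ → ∫ x, (if t < w x / q x then q x else 0) ∂μ = 1 := fun t ht => by
    have e : (fun x => if t < w x / q x then q x else 0) = q :=
      funext fun x => if_pos (ht.trans_le (hb x))
    rw [e, hq1]
  have key : ∀ t, 0 < t → t < t₀ → 4 * Z ^ 2 / (3 * W) - 8 * Z ^ 3 / (9 * W ^ 2) * t = 1 := by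
    intro t ht htt
    have e := hramp t ht
    rw [hfull t htt] at e
    rcases le_total (4 * Z ^ 2 / (3 * W) - 8 * Z ^ 3 / (9 * W ^ 2) * t) 0 with h | h
    · rw [max_eq_right h] at e
      exact absurd e one_ne_zero
    · rw [max_eq_left h] at e
      exact e.symm
  have e1 := key (t₀ / 2) (by positivity) (by linarith)
  have e2 := key (t₀ / 4) (by positivity) (by linarith)
  have hB : 0 < 8 * Z ^ 3 / (9 * W ^ 2) := by positivity
  have h0 : 8 * Z ^ 3 / (9 * W ^ 2) * (t₀ / 4) = 0 := by linarith
  exact (mul_pos hB (by positivity)).ne' h0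

/-- **`acc(p, q) > (8/9)·κ` in the normalised overlap form** (`p = w/Z`): for a weight bounded below,
`∫∫ min(p(x)q(y), p(y)q(x)) dμ dμ > (8/9)·Z²/W₂`. [ours] -/
theorem meanAccept_overlapForm_gt_eight_ninths_ESS (hw0 : ∀ t, 0 < w t) (hwm : Measurable w)
    (hwi : Integrable w μ) (hq0 : ∀ t, 0 < q t) (hqm : Measurable q) (hqi : Integrable q μ)
    (hq1 : ∫ z, q z ∂μ = 1) (hW₂ : Integrable (fun x => w x / q x * w x) μ)
    {t₀ : ℝ} (ht₀ : 0 < t₀) (hb : ∀ x, t₀ ≤ w x / q x) :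
    8 * (∫ z, w z ∂μ) ^ 2 / (9 * ∫ z, w z / q z * w z ∂μ)
      < ∫ x, ∫ y, min (w x / (∫ z, w z ∂μ) * q y) (w y / (∫ z, w z ∂μ) * q x) ∂μ ∂μ := by
  set Z : ℝ := ∫ z, w z ∂μ with hZdef
  have hZ : 0 < Z := integral_pos_of_pos hw0 hwi hq1
  have h := integral_integral_min_mul_gt_eight_ninths_of_weight_ge hw0 hwm hwi hq0 hqm hqi hq1 hW₂
    ht₀ hb
  rw [← hZdef] at h
  have e : ∀ x, ∫ y, min (w x / Z * q y) (w y / Z * q x) ∂μ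
      = (∫ y, min (w x * q y) (w y * q x) ∂μ) / Z := by
    intro x
    rw [← integral_div]
    refine integral_congr_ae (Filter.Eventually.of_forall fun y => ?_)
    show min (w x / Z * q y) (w y / Z * q x) = min (w x * q y) (w y * q x) / Z
    rw [← min_div_div_right hZ.le]
    congr 1 <;> ring
  simp_rw [e]
  rw [integral_div, lt_div_iff₀ hZ]
  calc 8 * Z ^ 2 / (9 * ∫ z, w z / q z * w z ∂μ) * Z = 8 * Z ^ 3 / (9 * ∫ z, w z / q z * w z ∂μ) := by
        field_simp
    _ < _ := h

end General

/-! ## §2 The untrained Wilson sampler of any compact gauge group: strict floor at every `β` -/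

section Wilson

variable {d L N : ℕ} [NeZero L] {G : Type*} [Group G] [TopologicalSpace G] [IsTopologicalGroup G]
  [CompactSpace G] [MeasurableSpace G] [BorelSpace G] (ρ : G →* Matrix (Fin N) (Fin N) ℂ)
  (μ : Measure (GaugeConfig d L G)) [IsProbabilityMeasure μ]

omit [NeZero L] [MeasurableSpace G] [BorelSpace G] in
/-- `Re tr ρ(h) ≥ −N` for a continuous representation of a compact group. [folklore] -/
theorem neg_le_re_trace_of_continuous (hρ : Continuous ρ) (h : G) : -(N : ℝ) ≤ (ρ h).trace.re := by
  have hb := Literature.RepresentationTheory.CompactGroups.CompactGroup.abs_re_trace_le_card ρ hρ h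
  rw [Fintype.card_fin] at hb
  exact (abs_le.1 hb).1

omit [MeasurableSpace G] [BorelSpace G] in
/-- **The Wilson action is bounded**: `S(U) ≤ 2N · #plaquettes`. [folklore] -/
theorem wilsonAction_le_card (hρ : Continuous ρ) (U : GaugeConfig d L G) :
    wilsonAction ρ U ≤ 2 * N * Fintype.card (Plaquette d L) := by
  unfold wilsonAction
  calc ∑ p : Plaquette d L, ((N : ℝ) - (ρ (plaquetteHolonomy U p.1 p.2.1.1 p.2.1.2)).trace.re)
      ≤ ∑ _p : Plaquette d L, (2 * (N : ℝ)) := Finset.sum_le_sum fun p _ => by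
        linarith [neg_le_re_trace_of_continuous ρ hρ (plaquetteHolonomy U p.1 p.2.1.1 p.2.1.2)]
    _ = 2 * N * Fintype.card (Plaquette d L) := by
        rw [Finset.sum_const, Finset.card_univ, nsmul_eq_mul]
        ring

omit [MeasurableSpace G] [BorelSpace G] in
/-- **The Boltzmann tilt is bounded below**: `e^{−βS(U)} ≥ e^{−2|β|N·#plaquettes}`. [folklore] -/
theorem exp_neg_mul_wilsonAction_ge (hρ : Continuous ρ) (β : ℝ) (U : GaugeConfig d L G) :
    Real.exp (-(2 * |β| * N * Fintype.card (Plaquette d L))) ≤ Real.exp (-β * wilsonAction ρ U) := by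
  refine Real.exp_le_exp.2 ?_
  have hS0 : 0 ≤ wilsonAction ρ U := wilsonAction_nonneg_of_re_trace_le ρ (fun h => by
    have hb := Literature.RepresentationTheory.CompactGroups.CompactGroup.abs_re_trace_le_card ρ hρ h
    rw [Fintype.card_fin] at hb
    exact (abs_le.1 hb).2) U
  have hS1 := wilsonAction_le_card ρ hρ U
  have hβ : -|β| ≤ -β ∨ -|β| ≤ β := by
    rcases le_or_gt 0 β with h | h
    · exact Or.inr (by linarith [abs_of_nonneg h])
    · exact Or.inl (by linarith [abs_of_neg h])
  nlinarith [abs_nonneg β, neg_abs_le β, le_abs_self β, hS0, hS1]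

/-- **STRICT `(8/9)·ESS` FLOOR FOR THE UNTRAINED WILSON SAMPLER**: for every compact `G`, continuous
`ρ`, `d`, `L`, reference probability law `μ` and EVERY `β`,
`(8/9)·Z(β)²/Z(2β) < ∫∫ min(p(U), p(U′)) dμ dμ`, `p = e^{−βS}/Z(β)`. [ours] -/
theorem wilsonIdentityFlow_meanAccept_gt (hρ : Continuous ρ) (β : ℝ) :
    8 / 9 * ((∫ V, Real.exp (-β * wilsonAction ρ V) ∂μ) ^ 2
        / ∫ U, Real.exp (-(2 * β) * wilsonAction ρ U) ∂μ)
      < ∫ U, ∫ U', min (Real.exp (-β * wilsonAction ρ U) / ∫ V, Real.exp (-β * wilsonAction ρ V) ∂μ)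
          (Real.exp (-β * wilsonAction ρ U') / ∫ V, Real.exp (-β * wilsonAction ρ V) ∂μ) ∂μ ∂μ := by
  have hw0 : ∀ U : GaugeConfig d L G, 0 < Real.exp (-β * wilsonAction ρ U) := fun U => Real.exp_pos _
  have hwm : Measurable fun U : GaugeConfig d L G => Real.exp (-β * wilsonAction ρ U) :=
    Real.measurable_exp.comp ((WilsonRP.measurable_wilsonAction ρ hρ).const_mul _)
  have hwi : Integrable (fun U : GaugeConfig d L G => Real.exp (-β * wilsonAction ρ U)) μ :=
    integrable_exp_mul_wilsonAction ρ hρ (-β) _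
  have hq0 : ∀ _U : GaugeConfig d L G, (0 : ℝ) < 1 := fun _ => one_pos
  have hqm : Measurable fun _ : GaugeConfig d L G => (1 : ℝ) := measurable_const
  have hqi : Integrable (fun _ : GaugeConfig d L G => (1 : ℝ)) μ := integrable_const _
  have hq1 : ∫ _U, (1 : ℝ) ∂μ = 1 := by rw [integral_const, probReal_univ, one_smul]
  have hW₂ : Integrable (fun U : GaugeConfig d L G =>
      Real.exp (-β * wilsonAction ρ U) / 1 * Real.exp (-β * wilsonAction ρ U)) μ := by
    simp_rw [div_one, ← sq, exp_neg_mul_wilsonAction_sq]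
    exact integrable_exp_mul_wilsonAction ρ hρ _ _
  have hW₂val : ∫ U, Real.exp (-β * wilsonAction ρ U) / 1 * Real.exp (-β * wilsonAction ρ U) ∂μ
      = ∫ U, Real.exp (-(2 * β) * wilsonAction ρ U) ∂μ := by
    simp_rw [div_one, ← sq, exp_neg_mul_wilsonAction_sq]
  have ht₀ : 0 < Real.exp (-(2 * |β| * N * Fintype.card (Plaquette d L))) := Real.exp_pos _
  have hb : ∀ U : GaugeConfig d L G, Real.exp (-(2 * |β| * N * Fintype.card (Plaquette d L)))
      ≤ Real.exp (-β * wilsonAction ρ U) / 1 := fun U => by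
    rw [div_one]
    exact exp_neg_mul_wilsonAction_ge ρ hρ β U
  have h := meanAccept_overlapForm_gt_eight_ninths_ESS (μ := μ) hw0 hwm hwi hq0 hqm hqi hq1 hW₂ ht₀ hb
  rw [hW₂val] at h
  simp_rw [mul_one] at h
  calc 8 / 9 * ((∫ V, Real.exp (-β * wilsonAction ρ V) ∂μ) ^ 2
        / ∫ U, Real.exp (-(2 * β) * wilsonAction ρ U) ∂μ)
      = 8 * (∫ V, Real.exp (-β * wilsonAction ρ V) ∂μ) ^ 2
          / (9 * ∫ U, Real.exp (-(2 * β) * wilsonAction ρ U) ∂μ) := by ring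
    _ < _ := h

/-- **`(8/9)·Z(β)²/Z(2β) < acc`** for the identity flow (`μ = Haar^{⊗E}`),
`Z = (partitionFunction ρ ·).toReal`, every `β`. [ours] -/
theorem wilsonIdentityFlow_meanAccept_gt_partitionFunction (hρ : Continuous ρ) (β : ℝ) :
    8 / 9 * ((partitionFunction (d := d) (L := L) ρ β).toReal ^ 2
        / (partitionFunction (d := d) (L := L) ρ (2 * β)).toReal)
      < ∫ U, ∫ U', min (Real.exp (-β * wilsonAction ρ U) / ∫ V, Real.exp (-β * wilsonAction ρ V)
            ∂(Measure.pi fun _ : Edge d L => haarProbability G))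
        (Real.exp (-β * wilsonAction ρ U') / ∫ V, Real.exp (-β * wilsonAction ρ V)
            ∂(Measure.pi fun _ : Edge d L => haarProbability G))
        ∂(Measure.pi fun _ : Edge d L => haarProbability G)
        ∂(Measure.pi fun _ : Edge d L => haarProbability G) := by
  rw [partitionFunction_toReal_eq_integral ρ hρ, partitionFunction_toReal_eq_integral ρ hρ]
  exact wilsonIdentityFlow_meanAccept_gt ρ _ hρ β

end Wilson

/-! ## §3 `V` independent U(1) plaquettes: strict floor at every `β` -/

section U1

variable {ι : Type*} [Fintype ι]

/-- `e^{β cos θ} ≥ e^{−|β|}`. [folklore] -/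
theorem exp_neg_abs_le_exp_mul_cos (β θ : ℝ) : Real.exp (-|β|) ≤ Real.exp (β * Real.cos θ) := by
  refine Real.exp_le_exp.2 ?_
  have h1 := Real.abs_cos_le_one θ
  have h2 : |β * Real.cos θ| ≤ |β| := by
    rw [abs_mul]
    exact mul_le_of_le_one_right (abs_nonneg β) h1
  linarith [neg_abs_le (β * Real.cos θ)]

/-- **STRICT `(8/9)·ESS` FLOOR FOR `V` UNTRAINED U(1) PLAQUETTES**: for every `β` and `V = card ι`,
`(8/9)·(I₀(β)²/I₀(2β))^V < acc_V` — GEN-12's sandwich is strict below (the importance ratio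
`∏ 2π e^{β cos θᵢ}/Z₁(β)` is bounded below by `(2π e^{−|β|}/Z₁(β))^V > 0`). [ours] -/
theorem u1IdentityFlow_meanAccept_gt (β : ℝ) :
    8 / 9 * (besselI 0 β ^ 2 / besselI 0 (2 * β)) ^ Fintype.card ι
      < ∫ x, ∫ x', min ((∏ i : ι, Real.exp (β * Real.cos (x i)) / onePlaquetteZ β)
            * ∏ _i : ι, (1 / (2 * π) : ℝ))
          ((∏ i : ι, Real.exp (β * Real.cos (x' i)) / onePlaquetteZ β) * ∏ _i : ι, (1 / (2 * π) : ℝ))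
          ∂(Measure.pi fun _ : ι => volume.restrict (Ioc (0 : ℝ) (2 * π)))
          ∂(Measure.pi fun _ : ι => volume.restrict (Ioc (0 : ℝ) (2 * π))) := by
  set ν : Measure ℝ := volume.restrict (Ioc (0 : ℝ) (2 * π)) with hν
  have hp0 : ∀ θ : ℝ, 0 ≤ Real.exp (β * Real.cos θ) / onePlaquetteZ β := fun θ => (u1Wilson_pos β θ).le
  have hq0 : ∀ _θ : ℝ, (0 : ℝ) ≤ 1 / (2 * π) := fun _ => by positivity
  have hpm := measurable_u1Wilson β
  have hqm : Measurable fun _ : ℝ => (1 / (2 * π) : ℝ) := measurable_const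
  have hpi := integrable_u1Wilson β
  have hqi := integrable_u1Haar
  obtain ⟨hP0, hPm, hPi, hP1⟩ := piDensity_facts (ι := ι) (μ := fun _ : ι => ν)
    (p := fun _ θ => Real.exp (β * Real.cos θ) / onePlaquetteZ β) (fun _ => hp0) (fun _ => hpm)
    fun _ => hpi
  obtain ⟨hQ0, hQm, hQi, hQ1⟩ := piDensity_facts (ι := ι) (μ := fun _ : ι => ν)
    (p := fun _ _ => (1 / (2 * π) : ℝ)) (fun _ => hq0) (fun _ => hqm) fun _ => hqi
  rw [prod_eq_one fun i _ => integral_u1Haar] at hQ1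
  rw [prod_eq_one fun i _ => integral_u1Wilson β] at hP1
  have hPpos : ∀ x : ι → ℝ, 0 < ∏ i, Real.exp (β * Real.cos (x i)) / onePlaquetteZ β :=
    fun x => prod_pos fun i _ => u1Wilson_pos β (x i)
  have hQpos : ∀ _x : ι → ℝ, (0 : ℝ) < ∏ _i : ι, (1 / (2 * π) : ℝ) :=
    fun _ => prod_pos fun i _ => by positivity
  have hW : ∀ x : ι → ℝ, (∏ i, Real.exp (β * Real.cos (x i)) / onePlaquetteZ β)
      / (∏ _i : ι, (1 / (2 * π) : ℝ)) * ∏ i, Real.exp (β * Real.cos (x i)) / onePlaquetteZ β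
      = ∏ i, ((Real.exp (β * Real.cos (x i)) / onePlaquetteZ β) ^ 2 / (1 / (2 * π))) := by
    intro x
    rw [← prod_div_distrib, ← prod_mul_distrib]
    exact prod_congr rfl fun i _ => by ring
  have hW1 : Integrable (fun θ : ℝ =>
      (Real.exp (β * Real.cos θ) / onePlaquetteZ β) ^ 2 / (1 / (2 * π))) ν := by
    have e : ∀ θ : ℝ, (Real.exp (β * Real.cos θ) / onePlaquetteZ β) ^ 2 / (1 / (2 * π))
        = 2 * π / onePlaquetteZ β ^ 2 * Real.exp (2 * β * Real.cos θ) := by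
      intro θ
      rw [div_pow, exp_mul_cos_sq]
      field_simp
    simp_rw [e]
    exact (integrableOn_exp_mul_cos (2 * β)).const_mul _
  have hW₂ : Integrable (fun x : ι → ℝ => (∏ i, Real.exp (β * Real.cos (x i)) / onePlaquetteZ β)
      / (∏ _i : ι, (1 / (2 * π) : ℝ)) * ∏ i, Real.exp (β * Real.cos (x i)) / onePlaquetteZ β)
      (Measure.pi fun _ : ι => ν) := by
    simp_rw [hW]
    exact Integrable.fintype_prod_dep (μ := fun _ : ι => ν) fun _ => hW1
  have hW₂val : ∫ x, (∏ i, Real.exp (β * Real.cos (x i)) / onePlaquetteZ β)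
      / (∏ _i : ι, (1 / (2 * π) : ℝ)) * ∏ i, Real.exp (β * Real.cos (x i)) / onePlaquetteZ β
      ∂(Measure.pi fun _ : ι => ν) = (besselI 0 (2 * β) / besselI 0 β ^ 2) ^ Fintype.card ι := by
    simp_rw [hW]
    rw [integral_fintype_prod_eq_prod (μ := fun _ : ι => ν)
      (fun (_ : ι) (θ : ℝ) => (Real.exp (β * Real.cos θ) / onePlaquetteZ β) ^ 2 / (1 / (2 * π))),
      prod_const, card_univ, integral_u1Wilson_sq_div]
  -- the importance ratio is bounded below
  have hZ1 : 0 < onePlaquetteZ β := onePlaquetteZ_pos β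
  have ht₀ : 0 < (2 * π * Real.exp (-|β|) / onePlaquetteZ β) ^ Fintype.card ι := by positivity
  have hb : ∀ x : ι → ℝ, (2 * π * Real.exp (-|β|) / onePlaquetteZ β) ^ Fintype.card ι
      ≤ (∏ i, Real.exp (β * Real.cos (x i)) / onePlaquetteZ β) / ∏ _i : ι, (1 / (2 * π) : ℝ) := by
    intro x
    rw [← prod_div_distrib, ← card_univ, ← prod_const]
    refine prod_le_prod (fun i _ => by positivity) fun i _ => ?_
    have e : Real.exp (β * Real.cos (x i)) / onePlaquetteZ β / (1 / (2 * π))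
        = Real.exp (β * Real.cos (x i)) * (2 * π) / onePlaquetteZ β := by
      rw [div_div_eq_mul_div, div_one, div_mul_eq_mul_div]
    rw [e]
    refine div_le_div_of_nonneg_right ?_ hZ1.le
    calc 2 * π * Real.exp (-|β|) = Real.exp (-|β|) * (2 * π) := mul_comm _ _
      _ ≤ Real.exp (β * Real.cos (x i)) * (2 * π) :=
          mul_le_mul_of_nonneg_right (exp_neg_abs_le_exp_mul_cos β (x i)) (by positivity)
  have h := meanAccept_overlapForm_gt_eight_ninths_ESS (μ := Measure.pi fun _ : ι => ν)
    hPpos hPm hPi hQpos hQm hQi hQ1 hW₂ ht₀ hb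
  rw [hP1, hW₂val] at h
  simp_rw [div_one] at h
  have hI2 : 0 < besselI 0 (2 * β) := besselI_zero_pos _
  have hI : 0 < besselI 0 β := besselI_zero_pos _
  calc 8 / 9 * (besselI 0 β ^ 2 / besselI 0 (2 * β)) ^ Fintype.card ι
      = 8 * 1 ^ 2 / (9 * (besselI 0 (2 * β) / besselI 0 β ^ 2) ^ Fintype.card ι) := by
        rw [div_pow, div_pow, one_pow]
        field_simp
    _ < _ := h

end U1

end Summit.Ventures.LatticeQCDFlow.Theory2
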